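import Mathlib
import HarnessLib
import HarnessLib.Audit
import Summits.CriticalPhenomena.Statement
import Literature.Probability.RandomPlanarGeometry.SupercriticalSAWPolygons
import Literature.Probability.RandomPlanarGeometry.CLE
import Literature.Probability.RandomPlanarGeometry.SLE
import Literature.Probability.RandomPlanarGeometry.SelfAvoidingWalk
import HarnessLib.Audit.Status.Attr

/-!
Route: SAWLoopLift

DORMANT since 2026-08-22T06:27:08Z (reconciler: no traction for 5.1 d (last activity item-evidence-added at 2026-08-17T02:39:06Z); parked, not closed — `ledger route dormant route-CriticalPhenomena-SAWLoopLift --off` to reactivate) — unstaffed, not closed; items shared with open routes are served there. `ledger route dormant <id> --off` reactivates.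

LOOP LIFT (idea card CriticalPhenomena/SAWScalingLimit/sap-gas-werner-loop-lift-cutting). Lift the
chordal problem to the whole-plane critical self-avoiding POLYGON gas ν_δ = Σ_P x_c^{|P|} δ_P on
δℤ², identify its fine-mesh limit with Werner's SLE(8/3) loop measure through Werner's scalar
characterisation (mass of loops in U around z leaving V = c·log Φ'_{V→U}(z), arXiv:math/0511605
Prop. 3), and cut along ∂Ω: conditioned on crossing ∂Ω only inside ε-gates at a and b, the inside
arc of a polygon is (asymptotically exactly) the chordal x_c-SAW of (Ω_δ; a_δ, b_δ). Everything is
phrased through AVOIDANCE MASSES of trace events (loops as points of the Hausdorff hyperspace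
NonemptyCompacts ℂ), so no sub-arc surgery is needed and hyperspace compactness is free.
It suffices to show X = C1 ∧ C2 ∧ C3 ∧ C4 ∧ C5:
 C1 ConformalRadiusLaw (rank 2, the conformal content, scalar): ∃ c > 0, for Jordan V ⊆ U, z ∈ V,
the x_c-weighted number of polygons of δℤ² drawn in U, surrounding z, not drawn in V tends to
c·log(|φ_U'(0)|/|φ_V'(0)|) (φ_U, φ_V : 𝔻 → U, V conformal, 0 ↦ z) as δ → 0⁺.
 C3 BoundaryMixing (rank 3, lattice): |P_δ^{SAW(Ω_δ;a_δ,b_δ)}(γ ∩ K = ∅) − ν_δ(G_ε ∩ {T ∩ K =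
∅})/ν_δ(G_ε)| → 0 as δ → 0⁺ then ε → 0⁺, where G_ε = polygons in a window B(0,R) that avoid ∂Ω
outside B(a,ε) ∪ B(b,ε), meet both gates, meet Ω and ℂ∖Ω̄ away from the gates; K ⊆ Ω compact,
regular closed.
 C2 GasRegularity (rank 4, lattice → continuum): if C1 holds with constant c then for every window
there is a measure ν on NonemptyCompacts ℂ carried by simple-loop traces with the conformal-radius
masses (constant c) such that ν_δ(G_ε) → ν(G_ε) ∈ (0,∞) and ν_δ(G_ε ∩ avoid K) → ν(G_ε ∩ avoid K)
for all small ε.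
 C4 GateFactorisation (rank 5, continuum): for ANY measure ν on simple loops with the
conformal-radius masses, ν(G_ε ∩ avoid K)/ν(G_ε) → μ(γ ∩ K = ∅) as ε → 0⁺, μ the chordal SLE(8/3)
law of (Ω; a, b) (Literature.Probability.RandomPlanarGeometry.IsSLELaw (8/3)).
 C5 AvoidanceToCurves (rank 6, chordal sets-to-curves): P_δ(γ ∩ K = ∅) → μ(γ ∩ K = ∅) for all
compact regular-closed K ⊆ Ω upgrades to
Literature.Probability.RandomPlanarGeometry.ConvergesInLawToSLE (8/3).
X → SAWScalingLimit is the PROVED deciding theorem of the route file (D-0027, rev 1): closes :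
SLELawExists → ConformalRadiusLaw → GasRegularity → BoundaryMixing → GateFactorisation →
AvoidanceToCurves → SAWScalingLimit, where SLELawExists (support, provable now from
exists_isSLECurve_eightThirds) supplies a chordal SLE_{8/3} law μ of (D; a, b). Proof (ε/3, no
measure theory): given (D; a_δ, b_δ), C5 reduces convergence in law to P_δ(avoid K) → μ(avoid K) for
compact regular-closed K ⊆ Ω; R with closure Ω ⊆ B(0,R) from boundedness; C1 gives c, C2 gives ν, a
gate threshold ε₀ and the δ-limits of the two gate masses (denominator limit ν(G_ε) ∈ (0,∞), so
Tendsto.div), C4 the ε-limit of their ratio = μ(avoid K), C3 ties P_δ to the lattice ratio; pick ε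
by Eventually.exists on 𝓝[>]0 and combine the three η/3 bounds.
Lean (one line, decls of this route file): ConformalRadiusLaw ∧ GasRegularity ∧ BoundaryMixing ∧
GateFactorisation ∧ AvoidanceToCurves; constants:
Literature.Probability.RandomPlanarGeometry.SAW.{IsPolygon, criticalFugacity, law, DomainSAW.curve,
IsEndpointApprox, SAWScalingLimit}, Literature.Probability.LatticeModels.{Site, zdGraph, meshPoint},
Literature.Probability.RandomPlanarGeometry.{JordanDomain, DobrushinDomain, ConformalEquiv,
CurveClass.simpleLoop, CurveClass.range, IsSLELaw, ConvergesInLawToSLE},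
TopologicalSpace.NonemptyCompacts ℂ with its Borel σ-algebra bound in-statement (letI := borel _; no
percolation import); Mathlib connectedComponentIn, Bornology.IsBounded, segment, tsum. The deciding
theorem additionally consumes the support item SLELawExists (∀ D, ∃ μ, IsSLELaw (8/3) D μ).

Rationale: WHY THIS LINE. Werner (arXiv:math/0511605 = Werner2008SelfAvoidingLoops: Thm 1, Prop. 3/Lemma 4 and
their 2-page proof, §7.1 Conj. 1) shows that a measure on simple planar loops is pinned down, up to
one constant, by the SCALAR family "mass of loops in U surrounding z that leave V" = c log Φ'(z);
LSW04 (LawlerSchrammWerner2004SAW §4.4) and Werner run the SAW and SAP conjectures in parallel from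
conformal invariance. We reverse the flow: the chordal conjunct on δℤ² is DERIVED from the loop gas,
whose conformal content is a single enumerative statement about x_c-weighted polygon counts around a
hole (C1), by an exact lattice CUTTING identity (a polygon crossing ∂Ω at two prescribed boundary
edges = inside SAW ⊗ outside SAW, weights multiply; chordal twin of the Kennedy–Lawler cut-curve
ensemble, KennedyLawler2013 §1.2) and its continuum counterpart (C4: two-sided decomposition of the
SLE_{8/3} = Werner loop, Zhan2021SLELoopMeasures Thm 1.1 + p.25, plus LSW03 restriction,
LawlerSchrammWerner2003Restriction). Imported areas: conformal restriction / SLE loop-measure theory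
(continuum side), random closed sets & hyperspace weak convergence (Matheron–Fell; compactness of
NonemptyCompacts of a closed disc makes precompactness free, only LOCAL MASS bounds and simplicity
are lattice inputs), enumerative combinatorics of polygons (C1 is testable by transfer matrices on
annuli, Guttmann–Jensen technology). The loop object is translation invariant and boundary-free:
Kennedy–Lawler lattice effects enter only in the last, ratio-type step C3.
RANKED CRUXES (decls of Theses/SAWLoopLift.lean; all eventual in δ, no IsTightLaws — cf. negative
stmt-0772):
 r2 ConformalRadiusLaw — the conformal content; cheapest to refute numerically (annulus transfer
matrices: does the polygon sum depend on (V,U) only through log CR-ratio, one c?).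
 r3 BoundaryMixing — hidden hard step: the macroscopic inside arc forgets how it is pinned near a, b
(gate-conditioned gas vs lattice-point endpoints); a near-boundary
ratio-mixing/quasi-multiplicativity statement for critical SAW; implies endpoint robustness.
 r4 GasRegularity — lattice→continuum for the gas: uniform local mass bounds, subsequential
hyperspace limits carried by SIMPLE loops (no macroscopic pinching), continuity of the gate/CR
events; then Werner determination (support item) upgrades C1 to convergence on gate events.
 r5 GateFactorisation — continuum only: for a Werner-type measure the two-gate-pinned inside arc is
asymptotically chordal SLE_{8/3}(Ω;a,b) in avoidance form; from Zhan's two-sided whole-plane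
SLE_{8/3} decomposition + chordal restriction + pinning limits; not in print.
 r6 AvoidanceToCurves — generic chordal sets-to-curves step (eventual tightness + simple limits +
Matheron determination); shared in spirit with every SAW route.
 support WernerDetermination — two hyperspace measures on simple loops in a window with the same
conformal-radius masses coincide (Werner's proof of Prop. 3, Jordan pairs suffice by exhaustion).
 support SLELawExists — a chordal SLE_{8/3} law exists in every Dobrushin domain (∀ D, ∃ μ, IsSLELaw
(8/3) D μ); provable now in two lines from Literature exists_isSLECurve_eightThirds (Rohde–Schramm
Thm 5.1 + 7.1, κ = 8/3 ≠ 8); filed as an item rather than imported so that the route file does not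
pull the ~264-module SLE-existence chain into its cone.
 DECIDING THEOREM (D-0027 §2.1, proved in the route file, rev 1): closes : SLELawExists → C1 → C2 →
C3 → C4 → C5 → SAWScalingLimit — an ε/3 argument (Metric.tendsto_nhds, Eventually.exists on 𝓝[>]0,
Tendsto.div with denominator ν(G_ε) ∈ (0,∞)), no measure theory; the legacy Assembly item (C1 → … →
C5 → SAWScalingLimit, rank 1) is no longer the deciding device and not a hypothesis of closes; it
stays filed (the gate keeps assembly items) and is provable in two lines from closes once
SLELawExists is discharged (exists_isSLECurve_eightThirds).
KILL CRITERIA. ¬C1 (a (V,U)-dependence not through the conformal-radius ratio, or c not universal)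
refutes Werner's SAP conjecture on ℤ² and closes the route. ¬C4 kills the descent but leaves C1+C2
as a route to Werner's Conjecture 1 only (close as exhausted for the conjunct). ¬C3 with C4 true
would exhibit persistent lattice effects in the pinned chordal law — evidence against the conjunct
as typed (all endpoint approximations). ¬C5 can only come from failure of tightness/simplicity,
which kills the conjunct for every route.
NOT DECOMPOSED YET: the cutting identity as a typed lattice lemma (needs polygon surgery API; rides
with --supports BoundaryMixing); local mass bounds vs simplicity inside C2 (candidate split C2 →
{LocalMass, SimpleLimits, EventContinuity}); the pinning calculus inside C4 (Zhan CMP → restriction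
→ ε→0); RW-loop-soup / percolation-frontier comparison ensembles for C1 (the card's 'shadows') are a
proof strategy, not items. Definition requests filed: polygon trace / critical polygon mass (to
shrink signatures), Werner-type measure predicate.
CHEAPEST FALSIFIER. C1 on the lattice, numerically, before anything else: by transfer matrices /
exact enumeration (Guttmann–Jensen polygon technology, cf. arXiv:1306.1299) compute at x_c = 1/μ the
x_c-weighted sums of polygons of δℤ² drawn in U, surrounding z and not drawn in V for two nested
Jordan pairs (V,U), (V',U') with EQUAL conformal-radius ratio |φ_U'(0)|/|φ_V'(0)| but different
shapes (centred square-in-square vs off-centre disc-in-rectangle), at δ⁻¹ = 12 … 40 (transfer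
matrices while the strip width allows, grand-canonical BFACF-type polygon MCMC at x_c beyond),
extrapolated in δ. C1 predicts the same δ → 0 limit c·log(CR ratio) for both pairs with ONE constant
c; a shape dependence at fixed CR ratio, or a pair-dependent c, beyond extrapolation error kills C1
and with it the route (KILL CRITERIA, ¬C1).

Novelty: NOVELTY (search-before-claim). Searches run 2026-08-15: `lit search --hybrid "self-avoiding polygons
scaling limit Werner conformally invariant measure self-avoiding loops"` (10 held books: Lawler
2005, Madras–Slade, Guttmann (ed.) Polygons…, Janse van Rensburg — textbook treatments only); `lit
search --source s2 "self-avoiding loops Werner measure lattice polygons scaling limit"` (12: LSW04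
math/0204277, Werner surveys math/0511268 & doi:10.4171/022-3/38, Ang–Holden–Sun arXiv:2205.05074
SLE loop via welding); `lit galaxy search "self-avoiding loops" / "self-avoiding polygon" --star
all|pdf` (enumeration/physics hits only); `lit frontier CriticalPhenomena --since 2020`
(Krachun–Panagiotis quantitative sub-ballisticity; CLE connectivities); reads: arXiv:math/0511605
pp.3-4,7-9,17,20-21; arXiv:1109.3091 pp.4-5,11; arXiv:1702.08026 pp.4-5,25; plus the card's refuter
audit (0902.1626 Bauer, 2401.03600, 1402.2433, 2203.12398 Ang–Remy–Sun, zbMATH sweeps).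
OpenAlex/arXiv APIs rate-limited today.
Nearest prior art: Werner2008SelfAvoidingLoops (arXiv:math/0511605): Thm 1, Prop. 3/Lemma 4 (the
characterising identity = our C1 transcribed to the lattice, and the determination argument =
support item), §7.1 Conjecture 1 (the x_c-SAP gas on δL converges; 'if conformally invariant it is
cμ'); LawlerSchrammWerner2004SAW §4.4 (SAP soup ↔ Brownian loop hulls); KennedyLawler2013
(arXiv:1109.3091) §1.2 radial cut-curve ensemble ('the boundary of the domain cuts the SAW into two
SAWs'; for c = 0  [refs: 10.4171/022-3/38, 2205.05074, math/0511605, 1109.3091, 1702.08026, doi:10.4171/022-3/38, KennedyLawler2013]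

Barriers (technique_class: loop-measure-lift, conformal-restriction, cutting, sle-cle): technique_class: loop-measure-lift, conformal-restriction, cutting, sle-cle (also: hyperspace
avoidance functionals, Werner determination)
- Literature.Barriers.CriticalPhenomena.NienhuisWeightsExcludeVertexSAW: does not apply — no
discrete-holomorphic/parafermionic observable and no exact local linear relation on ℤ² is used;
identification is measure-theoretic (Werner determination from scalar masses).
- Literature.Barriers.CriticalPhenomena.ParafermionicHalfCauchyRiemann: does not apply — same
reason; nothing rests on vertex relations or a Riemann–Hilbert problem.
- Literature.Barriers.CriticalPhenomena.SAPAnisotropicNotDFinite: applies to any attempt to prove C1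
by a closed-form/D-finite solution of polygon generating functions; evaded in statement — C1 is an
asymptotic statement about differences of x_c-weighted polygon sums in lattice approximations of
(V,U), no generating function is solved; the bet is comparison/coupling (RW loop-soup outer
boundaries, percolation perimeters: same polygons, proven Werner-type limits) or multiscale
arguments, not exact solution.
- Literature.Barriers.CriticalPhenomena.GridSAWCountingSharpPComplete: applies to exact evaluation
of SAW/SAP counts on arbitrary subgraphs; evaded — only δ → 0 asymptotics of weighted counts on
discretised Jordan domains are claimed; numerical tests of C1 use annuli/rectangles where transfer
matrices are feasible, as evidence not proof.
- Literature.Barriers.CriticalPhenomena.SupercriticalSAWSpaceFilling: appli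

History (route lifecycle, newest last):
- 2026-08-22T06:27:08Z · DORMANT — reconciler: no traction for 5.1 d (last activity item-evidence-added at 2026-08-17T02:39:06Z); parked, not closed — `ledger route dormant route-CriticalPhenomen (operator:999:2870691)

sub-problem: SAWScalingLimit · status: dormant · opened planner-plancard-CriticalPhenomena-SAWScaling-60930995-0 2026-08-15T11:35:16Z · rev 2 · ledger route-CriticalPhenomena-SAWLoopLift
GENERATED by the gate from the ledger (D-0016/17). Provers cite these decls: `theorem foo : Summit.CriticalPhenomena.SAWScalingLimit.Theses.SAWLoopLift.<Decl> := …` in Summits/CriticalPhenomena/SAWScalingLimit/Theorems/<Name>.lean.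
-/

namespace Summit.CriticalPhenomena.SAWScalingLimit.Theses.SAWLoopLift

open scoped BigOperators Topology Manifold Classical MeasureTheory ProbabilityTheory Matrix InnerProductSpace ComplexConjugate ContinuousMap
open Filter Set Function TopologicalSpace MeasureTheory

attribute [summit_statement] _root_.SAWScalingLimit

/-- item stmt-CriticalPhenomena-4846 · crux · rank 2 · open · by planner
why it might fail: Full conformal content (as hard as the 5/8 restriction formula): the limit may fail to exist, depend on (V,U) not through the conformal-radius ratio (anisotropy/embedding, Beffara), or need a pair-dependent c. Numerically testable on lattice annuli.
sources: Werner2008SelfAvoidingLoops Prop. 3, Lemma 4, §7.1 Conj. 1, LawlerSchrammWerner2004SAW §4.4, arXiv:1306.1299 (series tests of SLE predictions for SAW/SAP)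
[crux] Conformal-radius law for the critical polygon gas (Werner's characterising identity,
arXiv:math/0511605 Prop. 3 / Lemma 4, transcribed to δℤ²): there is ONE constant c > 0 such that for
all Jordan domains V ⊆ U and z ∈ V, Σ {x_c^{|P|} : P a self-avoiding polygon of δℤ² (SAW.IsPolygon
(zdGraph 2), x_c = SAW.criticalFugacity) whose closed-edge trace lies in U, surrounds z (z off the
trace, bounded complementary component of z) and is not contained in V} → c · log(|φ_U'(0)| /
|φ_V'(0)|) as δ → 0⁺, where φ_U, φ_V : 𝔻 → U, V are conformal with 0 ↦ z (the limit is c · log of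
the ratio of conformal radii = c log Φ'_{V→U}(z)). Why it might fail: it is the full conformal
content (as strong as the 5/8 restriction formula); the limit may not exist, or exist with a
(V,U)-dependence not through the conformal-radius ratio (embedding/anisotropy, Beffara), or with a
pair-dependent c; cheapest test: transfer-matrix polygon sums in lattice annuli / rectangles with a
hole to 3–4 digits. Sources: Werner2008SelfAvoidingLoops Prop. 3, Lemma 4, §7.1 Conj. 1;
LawlerSchrammWerner2004SAW §4.4; arXiv:1306.1299 (series tests of SLE predictions for SAW/SAP). -/
@[route_item "route-CriticalPhenomena-SAWLoopLift", crux]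
def ConformalRadiusLaw : Prop :=
  let tr : ℝ → Finset (Sym2 (Literature.Probability.LatticeModels.Site 2)) → Set ℂ := fun δ E => {p : ℂ | ∃ x y : Literature.Probability.LatticeModels.Site 2, s(x, y) ∈ E ∧ p ∈ segment ℝ (Literature.Probability.LatticeModels.meshPoint δ x) (Literature.Probability.LatticeModels.meshPoint δ y)}; let M : ℝ → (Set ℂ → Prop) → ℝ := fun δ P => ∑' E : Finset (Sym2 (Literature.Probability.LatticeModels.Site 2)), (if Literature.Probability.RandomPlanarGeometry.SAW.IsPolygon (Literature.Probability.LatticeModels.zdGraph 2) E ∧ P (tr δ E) then Literature.Probability.RandomPlanarGeometry.SAW.criticalFugacity ^ E.card else (0 : ℝ)); ∃ c : ℝ, 0 < c ∧ ∀ (U V : Literature.Probability.RandomPlanarGeometry.JordanDomain) (z : ℂ) (φ : Literature.Probability.RandomPlanarGeometry.ConformalEquiv (Metric.ball (0 : ℂ) 1) U.carrier) (ψ : Literature.Probability.RandomPlanarGeometry.ConformalEquiv (Metric.ball (0 : ℂ) 1) V.carrier), V.carrier ⊆ U.carrier → z ∈ V.carrier → φ 0 = z → ψ 0 = z → Filter.Tendsto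 (fun δ : ℝ => M δ (fun T => T ⊆ U.carrier ∧ z ∉ T ∧ Bornology.IsBounded (connectedComponentIn Tᶜ z) ∧ ¬ T ⊆ V.carrier)) (nhdsWithin (0 : ℝ) (Set.Ioi 0)) (nhds (c * Real.log (‖deriv φ 0‖ / ‖deriv ψ 0‖)))

/-- item stmt-CriticalPhenomena-4847 · crux · rank 3 · open · by planner
why it might fail: Kennedy–Lawler boundary lattice effects could persist in the conditional LAW of the inside arc, not only in crossing densities; multi-crossing gate configurations must be negligible uniformly in δ; general IsEndpointApprox (depth ≫ δ, tangential approach) is included.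
sources: KennedyLawler2013 §1.2 and §4, LawlerSchrammWerner2004SAW §3.4.5 (lattice restriction identity), arXiv:0909.0203 (Alberts–Duminil-Copin bridge decomposition), MadrasSlade1993 Ch. 4, 7 (Kesten patterns, bridges)
[crux] Cutting along ∂Ω, lattice side: for every Dobrushin domain (Ω; a, b), endpoint approximation
(a_δ, b_δ) (SAW.IsEndpointApprox), window radius R with closure Ω ⊆ B(0,R) and compact
regular-closed K ⊆ Ω: lim_{ε→0⁺} limsup_{δ→0⁺} | P_δ(range γ ∩ K = ∅) − ν_δ(G_ε ∩ {T ∩ K = ∅}) /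
ν_δ(G_ε) | = 0, where P_δ = SAW.law Ω δ a_δ b_δ is the critical chordal SAW law, ν_δ = Σ_P x_c^{|P|}
δ_{trace P} the polygon gas of δℤ², and G_ε = traces inside B(0,R) that avoid ∂Ω ∖ (B(a,ε) ∪
B(b,ε)), meet both gates, and meet Ω and ℂ ∖ Ω̄ away from the gates. Mechanism: a polygon crossing
∂Ω along exactly two prescribed boundary edges is (inside SAW) ⊕ (outside SAW) with multiplicative
weight, so given the crossing edges the inside arc has EXACTLY the chordal x_c-SAW law (the cutting
identity of the rationale, KennedyLawler2013 §1.2 chordal twin; a prover states it with --supports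
BoundaryMixing); the statement says the macroscopic inside arc forgets the microscopic pinning data
(gate configuration with many crossings vs lattice endpoints, possibly at depth ≫ δ). Why it might
fail: persistent boundary lattice effects (Kennedy–Lawler l(θ)) might survive in the conditional LAW
and not only in crossing -/
@[route_item "route-CriticalPhenomena-SAWLoopLift", crux]
def BoundaryMixing : Prop :=
  let tr : ℝ → Finset (Sym2 (Literature.Probability.LatticeModels.Site 2)) → Set ℂ := fun δ E => {p : ℂ | ∃ x y : Literature.Probability.LatticeModels.Site 2, s(x, y) ∈ E ∧ p ∈ segment ℝ (Literature.Probability.LatticeModels.meshPoint δ x) (Literature.Probability.LatticeModels.meshPoint δ y)}; let M : ℝ → (Set ℂ → Prop) → ℝ := fun δ P => ∑' E : Finset (Sym2 (Literature.Probability.LatticeModels.Site 2)), (if Literature.Probability.RandomPlanarGeometry.SAW.IsPolygon (Literature.Probability.LatticeModels.zdGraph 2) E ∧ P (tr δ E) then Literature.Probability.RandomPlanarGeometry.SAW.criticalFugacity ^ E.card else (0 : ℝ)); ∀ (D : Literature.Probability.RandomPlanarGeometry.DobrushinDomain) (a b : ℝ → Literature.Probability.LatticeModels.Site 2), Literature.Probability.RandomPlanarGeometry.SAW.IsEndpointApprox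 D a b → ∀ (R : ℝ), closure D.carrier ⊆ Metric.ball (0 : ℂ) R → let G : ℝ → Set ℂ → Prop := fun ε T => T ⊆ Metric.ball (0 : ℂ) R ∧ T ∩ (frontier D.carrier \ (Metric.ball (D.pt 0) ε ∪ Metric.ball (D.pt 1) ε)) = ∅ ∧ (T ∩ (D.carrier \ closure (Metric.ball (D.pt 0) ε ∪ Metric.ball (D.pt 1) ε))).Nonempty ∧ (T ∩ (closure D.carrier ∪ closure (Metric.ball (D.pt 0) ε ∪ Metric.ball (D.pt 1) ε))ᶜ).Nonempty ∧ (T ∩ Metric.ball (D.pt 0) ε).Nonempty ∧ (T ∩ Metric.ball (D.pt 1) ε).Nonempty; ∀ (K : Set ℂ), IsCompact K → K ⊆ D.carrier → closure (interior K) = K → ∀ η : ℝ, 0 < η → ∃ ε₀ : ℝ, 0 < ε₀ ∧ ∀ ε : ℝ, 0 < ε → ε < ε₀ → ∀ᶠ δ : ℝ in (nhdsWithin (0 : ℝ) (Set.Ioi 0)), |((Literature.Probability.RandomPlanarGeometry.SAW.law D.carrier δ (a δ) (b δ)) {γ | γ.curve.range ∩ K = ∅}).toReal - M δ (fun T =>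 G ε T ∧ T ∩ K = ∅) / M δ (G ε)| < η

/-- item stmt-CriticalPhenomena-4848 · crux · rank 4 · open · by planner
why it might fail: Uniform local finiteness of the x_c-polygon gas (mass of polygons of diameter ≥ r meeting a window) and no macroscopic pinching of limits are open on ℤ² (they encode SAP exponents; even Σ p_n μ^-n < ∞ is unknown in d=2); non-simple limits escape Werner's π-system.
sources: Werner2008SelfAvoidingLoops §3, CamiaNewman2006 and AizenmanBurchard1999 (hyperspace/curve compactness), Literature.Probability.Percolation.OneArmScalingLimit (LSW EJP 2002 use of NonemptyCompacts), MadrasSlade1993 §3.2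
[crux] Lattice → continuum for the polygon gas on gate events, GIVEN the conformal-radius law with
constant c: for every window radius R there is a measure ν on the Hausdorff hyperspace
NonemptyCompacts ℂ (Borel structure of Literature.Probability.Percolation.OneArmScalingLimit),
ν-a.e. point the trace of a simple loop (CurveClass.simpleLoop) inside B(0,R), with ν{T ⊆ U, T
surrounds z, T ⊄ V} = c·log(|φ_U'(0)|/|φ_V'(0)|) for all Jordan V ⊆ U ⊆ B(0,R), such that for every
Dobrushin domain with closure in B(0,R) and all ε ∈ (0, ε₀): 0 < ν(G_ε) < ∞, ν_δ(G_ε) → ν(G_ε) and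
ν_δ(G_ε ∩ {T ∩ K = ∅}) → ν(G_ε ∩ {T ∩ K = ∅}) for compact regular-closed K ⊆ Ω. Intended proof
(candidate split LocalMass / SimpleLimits / EventContinuity): uniform local mass bounds for
macroscopic polygons in a window (finite measures on the compact hyperspace of a closed disc ⇒
subsequential limits for free); limits carried by SIMPLE loops (no macroscopic pinching, no hairs);
squeezing the CR events between Jordan pairs ⇒ every limit has the CR masses ⇒ (support
WernerDetermination) all limits agree ⇒ convergence on ν-continuity sets; gate events are continuity
sets since loops tangent to a fixed circle/arc are ν-n -/
@[route_item "route-CriticalPhenomena-SAWLoopLift", crux]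
def GasRegularity : Prop :=
  letI : MeasurableSpace (TopologicalSpace.NonemptyCompacts ℂ) := borel (TopologicalSpace.NonemptyCompacts ℂ); let tr : ℝ → Finset (Sym2 (Literature.Probability.LatticeModels.Site 2)) → Set ℂ := fun δ E => {p : ℂ | ∃ x y : Literature.Probability.LatticeModels.Site 2, s(x, y) ∈ E ∧ p ∈ segment ℝ (Literature.Probability.LatticeModels.meshPoint δ x) (Literature.Probability.LatticeModels.meshPoint δ y)}; let M : ℝ → (Set ℂ → Prop) → ℝ := fun δ P => ∑' E : Finset (Sym2 (Literature.Probability.LatticeModels.Site 2)), (if Literature.Probability.RandomPlanarGeometry.SAW.IsPolygon (Literature.Probability.LatticeModels.zdGraph 2) E ∧ P (tr δ E) then Literature.Probability.RandomPlanarGeometry.SAW.criticalFugacity ^ E.card else (0 : ℝ)); ∀ (c : ℝ), 0 < c → (∀ (U V : Literature.Probability.RandomPlanarGeometry.JordanDomain) (z : ℂ) (φ : Literature.Probability.RandomPlanarGeometry.ConformalEquiv (Metric.ball (0 : ℂ) 1) U.carrier) (ψ : Literature.Probability.RandomPlanarGeometry.ConformalEquiv (Metric.ball (0 : ℂ) 1)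 V.carrier), V.carrier ⊆ U.carrier → z ∈ V.carrier → φ 0 = z → ψ 0 = z → Filter.Tendsto (fun δ : ℝ => M δ (fun T => T ⊆ U.carrier ∧ z ∉ T ∧ Bornology.IsBounded (connectedComponentIn Tᶜ z) ∧ ¬ T ⊆ V.carrier)) (nhdsWithin (0 : ℝ) (Set.Ioi 0)) (nhds (c * Real.log (‖deriv φ 0‖ / ‖deriv ψ 0‖)))) → ∀ (R : ℝ), ∃ ν : MeasureTheory.Measure (TopologicalSpace.NonemptyCompacts ℂ), (∀ᵐ (T : TopologicalSpace.NonemptyCompacts ℂ) ∂ν, ∃ γ : Literature.Probability.RandomPlanarGeometry.CurveClass ℂ, γ ∈ (Literature.Probability.RandomPlanarGeometry.CurveClass.simpleLoop : Set (Literature.Probability.RandomPlanarGeometry.CurveClass ℂ)) ∧ γ.range = (T : Set ℂ)) ∧ (∀ᵐ (T : TopologicalSpace.NonemptyCompacts ℂ) ∂ν, (T : Set ℂ) ⊆ Metric.ball (0 : ℂ) R) ∧ (∀ (U V : Literature.Probability.RandomPlanarGeometry.JordanDomain) (z : ℂ) (φ : Literature.Probability.RandomPlanarGeometry.ConformalEquiv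 (Metric.ball (0 : ℂ) 1) U.carrier) (ψ : Literature.Probability.RandomPlanarGeometry.ConformalEquiv (Metric.ball (0 : ℂ) 1) V.carrier), U.carrier ⊆ Metric.ball (0 : ℂ) R → V.carrier ⊆ U.carrier → z ∈ V.carrier → φ 0 = z → ψ 0 = z → ν {T : TopologicalSpace.NonemptyCompacts ℂ | (T : Set ℂ) ⊆ U.carrier ∧ z ∉ (T : Set ℂ) ∧ Bornology.IsBounded (connectedComponentIn (T : Set ℂ)ᶜ z) ∧ ¬ (T : Set ℂ) ⊆ V.carrier} = ENNReal.ofReal (c * Real.log (‖deriv φ 0‖ / ‖deriv ψ 0‖))) ∧ ∀ (D : Literature.Probability.RandomPlanarGeometry.DobrushinDomain), closure D.carrier ⊆ Metric.ball (0 : ℂ) R → let G : ℝ → Set ℂ → Prop := fun ε T => T ⊆ Metric.ball (0 : ℂ) R ∧ T ∩ (frontier D.carrier \ (Metric.ball (D.pt 0) ε ∪ Metric.ball (D.pt 1) ε)) = ∅ ∧ (T ∩ (D.carrier \ closure (Metric.ball (D.pt 0) ε ∪ Metric.ball (D.pt 1) ε))).Nonempty ∧ (T ∩ (closure D.carrier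 ∪ closure (Metric.ball (D.pt 0) ε ∪ Metric.ball (D.pt 1) ε))ᶜ).Nonempty ∧ (T ∩ Metric.ball (D.pt 0) ε).Nonempty ∧ (T ∩ Metric.ball (D.pt 1) ε).Nonempty; ∃ ε₀ : ℝ, 0 < ε₀ ∧ ∀ ε : ℝ, 0 < ε → ε < ε₀ → 0 < ν {T : TopologicalSpace.NonemptyCompacts ℂ | G ε (T : Set ℂ)} ∧ ν {T : TopologicalSpace.NonemptyCompacts ℂ | G ε (T : Set ℂ)} < ⊤ ∧ Filter.Tendsto (fun δ : ℝ => M δ (G ε)) (nhdsWithin (0 : ℝ) (Set.Ioi 0)) (nhds (ν {T : TopologicalSpace.NonemptyCompacts ℂ | G ε (T : Set ℂ)}).toReal) ∧ ∀ K : Set ℂ, IsCompact K → K ⊆ D.carrier → closure (interior K) = K → Filter.Tendsto (fun δ : ℝ => M δ (fun T => G ε T ∧ T ∩ K = ∅)) (nhdsWithin (0 : ℝ) (Set.Ioi 0)) (nhds (ν {T : TopologicalSpace.NonemptyCompacts ℂ | G ε (T : Set ℂ) ∧ (T : Set ℂ) ∩ K = ∅}).toReal)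

/-- item stmt-CriticalPhenomena-4849 · crux · rank 5 · open · by planner
why it might fail: Singular conditioning: given the outside arc, staying in Ω has probability 0, so the ε→0 gate limit could depend on gate geometry or on roughness of ∂Ω at a,b; double-ring/bubble configurations must be subdominant for Werner's measure; not in print.
sources: Zhan2021SLELoopMeasures Thm 1.1, p. 25, Werner2008SelfAvoidingLoops §§4–5, LawlerSchrammWerner2003Restriction Prop. 3.3, Thm 6.1, KennedyLawler2013 §1.2 (radial analogue at c = 0), Hao Wu, Conformal restriction and Brownian motion, doi:10.1214/15-PS259 §§3–4
[crux] Cutting along ∂Ω, continuum side: for ANY measure ν on NonemptyCompacts ℂ carried by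
simple-loop traces in B(0,R) with the conformal-radius masses (constant c > 0) — by
WernerDetermination this is c × Werner's measure restricted to the window — and every Dobrushin
domain (Ω; a, b) with closure in B(0,R): ν(G_ε) ∈ (0, ∞) for small ε, and ν(G_ε ∩ {T ∩ K = ∅}) /
ν(G_ε) → μ{γ : range γ ∩ K = ∅} as ε → 0⁺ for every compact regular-closed K ⊆ Ω, where μ is the
chordal SLE_{8/3} law of (Ω; a, b) (IsSLELaw (8/3)). Expected from: Werner's measure = SLE_{8/3}
loop measure (Zhan2021SLELoopMeasures p. 25), two-sided whole-plane SLE_{8/3} ('conditional on one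
arc the other is chordal SLE_{8/3} in the complement', ibid. Thm 1.1), chordal restriction of
SLE_{8/3} (LawlerSchrammWerner2003Restriction) to pass from the complement of the outside arc to Ω,
and a pinning limit ε → 0 (continuity of chordal SLE_{8/3} in the marked prime ends; multi-crossing
configurations subdominant by boundary exponents 2·(5/8 + 5/8) < 2·2). Not in print. Why it might
fail: the pinned structure is a singular conditioning (given the outside arc, staying in Ω has
probability 0), so the ε → 0 limit of the gate-cond -/
@[route_item "route-CriticalPhenomena-SAWLoopLift", crux]
def GateFactorisation : Prop :=
  letI : MeasurableSpace (TopologicalSpace.NonemptyCompacts ℂ) := borel (TopologicalSpace.NonemptyCompacts ℂ); ∀ (ν : MeasureTheory.Measure (TopologicalSpace.NonemptyCompacts ℂ)) (c R : ℝ), 0 < c → (∀ᵐ (T : TopologicalSpace.NonemptyCompacts ℂ) ∂ν, ∃ γ : Literature.Probability.RandomPlanarGeometry.CurveClass ℂ, γ ∈ (Literature.Probability.RandomPlanarGeometry.CurveClass.simpleLoop : Set (Literature.Probability.RandomPlanarGeometry.CurveClass ℂ)) ∧ γ.range = (T : Set ℂ)) → (∀ᵐ (T : TopologicalSpace.NonemptyCompacts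 ℂ) ∂ν, (T : Set ℂ) ⊆ Metric.ball (0 : ℂ) R) → (∀ (U V : Literature.Probability.RandomPlanarGeometry.JordanDomain) (z : ℂ) (φ : Literature.Probability.RandomPlanarGeometry.ConformalEquiv (Metric.ball (0 : ℂ) 1) U.carrier) (ψ : Literature.Probability.RandomPlanarGeometry.ConformalEquiv (Metric.ball (0 : ℂ) 1) V.carrier), U.carrier ⊆ Metric.ball (0 : ℂ) R → V.carrier ⊆ U.carrier → z ∈ V.carrier → φ 0 = z → ψ 0 = z → ν {T : TopologicalSpace.NonemptyCompacts ℂ | (T : Set ℂ) ⊆ U.carrier ∧ z ∉ (T : Set ℂ) ∧ Bornology.IsBounded (connectedComponentIn (T : Set ℂ)ᶜ z) ∧ ¬ (T : Set ℂ) ⊆ V.carrier} = ENNReal.ofReal (c * Real.log (‖deriv φ 0‖ / ‖deriv ψ 0‖))) → ∀ (D : Literature.Probability.RandomPlanarGeometry.DobrushinDomain), closure D.carrier ⊆ Metric.ball (0 : ℂ) R → ∀ (μ : MeasureTheory.Measure (Literature.Probability.RandomPlanarGeometry.CurveClass ℂ)), Literature.Probability.RandomPlanarGeometry.IsSLELaw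 ((8 : NNReal) / 3) D μ → let G : ℝ → Set ℂ → Prop := fun ε T => T ⊆ Metric.ball (0 : ℂ) R ∧ T ∩ (frontier D.carrier \ (Metric.ball (D.pt 0) ε ∪ Metric.ball (D.pt 1) ε)) = ∅ ∧ (T ∩ (D.carrier \ closure (Metric.ball (D.pt 0) ε ∪ Metric.ball (D.pt 1) ε))).Nonempty ∧ (T ∩ (closure D.carrier ∪ closure (Metric.ball (D.pt 0) ε ∪ Metric.ball (D.pt 1) ε))ᶜ).Nonempty ∧ (T ∩ Metric.ball (D.pt 0) ε).Nonempty ∧ (T ∩ Metric.ball (D.pt 1) ε).Nonempty; ∀ (K : Set ℂ), IsCompact K → K ⊆ D.carrier → closure (interior K) = K → (∀ᶠ ε : ℝ in (nhdsWithin (0 : ℝ) (Set.Ioi 0)), 0 < ν {T : TopologicalSpace.NonemptyCompacts ℂ | G ε (T : Set ℂ)} ∧ ν {T : TopologicalSpace.NonemptyCompacts ℂ | G ε (T : Set ℂ)} < ⊤) ∧ Filter.Tendsto (fun ε : ℝ => (ν {T : TopologicalSpace.NonemptyCompacts ℂ | G ε (T : Set ℂ) ∧ (T : Set ℂ) ∩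 K = ∅}).toReal / (ν {T : TopologicalSpace.NonemptyCompacts ℂ | G ε (T : Set ℂ)}).toReal) (nhdsWithin (0 : ℝ) (Set.Ioi 0)) (nhds (μ {γ | γ.range ∩ K = ∅}).toReal)

/-- item stmt-CriticalPhenomena-4850 · crux · rank 6 · open · by planner
why it might fail: Fails only if eventual tightness / no-boundary-crawling / no-retracing of the critical ℤ² SAW fails under general IsEndpointApprox (no Aizenman–Burchard or Kemppainen–Smirnov crossing bound is known at x_c) — which would sink the conjunct itself.
sources: AizenmanBurchard1999 Thms 1.1–1.2, KemppainenSmirnov2017 (arXiv:1212.6215) Thm 1.5, LawlerSchrammWerner2003Restriction §3 (hull laws determined by avoidance), DuminilCopinHammond2013 (sub-ballisticity), Matheron 1975 Thm 2-2-1 (Choquet)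
[crux] Chordal sets-to-curves: for every Dobrushin domain, endpoint approximation and chordal
SLE_{8/3} law μ of (Ω; a, b): if P_δ(range(curve γ) ∩ K = ∅) → μ(range ∩ K = ∅) as δ → 0⁺ for every
compact regular-closed K ⊆ Ω, then ConvergesInLawToSLE (8/3) holds for (SAW.law, DomainSAW.curve).
Content: eventual tightness of the pushed-forward SAW laws on CurveClass ℂ (∃ δ₀, tight on (0, δ₀] —
NOT IsTightLaws over (0,1], cf. refuted stmt-CriticalPhenomena-0772), subsequential limits carried
by simple curves meeting ∂Ω only at a, b, and determination of a law on simple chords by its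
avoidance probabilities of regular-closed compacta (Matheron/Choquet π-system + Lusin–Souslin for
trace ↦ curve), with {range ∩ K = ∅} μ-continuity sets by continuity of the restriction formula
under shrinking K. Shared in substance with the eventual-tightness / SimpleOfLimit items of the
sibling routes (IsTightAlongMesh, convergesInLawToSLE_of_isTightAlongMesh may be reused). Why it
might fail: only through failure of tightness / no-boundary-crawling for the critical ℤ² SAW under
general IsEndpointApprox (no Aizenman–Burchard / Kemppainen–Smirnov crossing bound is known at x_c)
— which would sink the conju -/
@[route_item "route-CriticalPhenomena-SAWLoopLift", crux]
def AvoidanceToCurves : Prop :=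
  ∀ (D : Literature.Probability.RandomPlanarGeometry.DobrushinDomain) (a b : ℝ → Literature.Probability.LatticeModels.Site 2), Literature.Probability.RandomPlanarGeometry.SAW.IsEndpointApprox D a b → ∀ (μ : MeasureTheory.Measure (Literature.Probability.RandomPlanarGeometry.CurveClass ℂ)), Literature.Probability.RandomPlanarGeometry.IsSLELaw ((8 : NNReal) / 3) D μ → (∀ K : Set ℂ, IsCompact K → K ⊆ D.carrier → closure (interior K) = K → Filter.Tendsto (fun δ : ℝ => ((Literature.Probability.RandomPlanarGeometry.SAW.law D.carrier δ (a δ) (b δ)) {γ | γ.curve.range ∩ K = ∅}).toReal) (nhdsWithin (0 : ℝ) (Set.Ioi 0)) (nhds (μ {γ | γ.range ∩ K = ∅}).toReal)) → Literature.Probability.RandomPlanarGeometry.ConvergesInLawToSLE ((8 : NNReal) / 3) D (fun δ (γ : Literature.Probability.RandomPlanarGeometry.SAW.DomainSAW D.carrier δ (a δ) (b δ)) => γ.curve) (fun δ => Literature.Probability.RandomPlanarGeometry.SAW.law D.carrier δ (a δ) (b δ))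

/-- item stmt-CriticalPhenomena-10341 · support · rank 9 · closed · proved by Summit.CriticalPhenomena.SAWScalingLimit.Theorems.sawLoopLift_sleLawExists @ 263f8e6dbe3b (prover) · by planner
[support] Existence of the chordal SLE(8/3) law in every Dobrushin domain (D; a, b): some measure μ
on CurveClass ℂ is the law of a chordal SLE_{8/3} random curve in D (IsSLELaw (8/3) D μ). Needed by
the deciding theorem `closes` to instantiate the μ of GateFactorisation / AvoidanceToCurves.
PROVABLE NOW, two lines: `fun D => let ⟨Γ, hΓ⟩ :=
Literature.Probability.RandomPlanarGeometry.exists_isSLECurve_eightThirds D; ⟨_, hΓ.isSLELaw_map⟩`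
in a Theorems file importing Literature.Probability.RandomPlanarGeometry.SLEExistenceNeEightHolds
(Rohde–Schramm Thm 5.1 + 7.1, κ = 8/3 ≠ 8; kept out of the route imports on purpose: that module's
import closure is ~264 Literature modules). [difficulty: provable-now] Sources: RohdeSchramm2005 Thm
5.1, Thm 7.1; Lawler2005 §6.3. -/
@[route_item "route-CriticalPhenomena-SAWLoopLift", crux]
def SLELawExists : Prop :=
  ∀ D : Literature.Probability.RandomPlanarGeometry.DobrushinDomain, ∃ μ : MeasureTheory.Measure (Literature.Probability.RandomPlanarGeometry.CurveClass ℂ), Literature.Probability.RandomPlanarGeometry.IsSLELaw ((8 : NNReal) / 3) D μ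

/-- item stmt-CriticalPhenomena-4851 · support · rank 9 · closed · proved by Summit.CriticalPhenomena.SAWScalingLimit.Theorems.WernerDetermination.wernerDetermination_proof @ 73e5626f030a (prover) · by planner
sources: Werner2008SelfAvoidingLoops §3
[support] Werner's determination lemma in hyperspace form (citation-level: arXiv:math/0511605, proof
of Prop. 3 / Lemma 4, pp. 8–9): two measures on NonemptyCompacts ℂ, both carried by simple-loop
traces inside B(0,R) and giving every event {T ⊆ U, T surrounds z, T ⊄ V} (Jordan V ⊆ U ⊆ B(0,R), z
∈ V) the mass c·log(|φ_U'(0)|/|φ_V'(0)|) with the same c > 0, are equal. Jordan pairs suffice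
(exhaust simply connected domains by Jordan subdomains, finiteness from the CR masses); the Borel
σ-field of the Hausdorff metric restricted to simple loops is generated by Werner's annular events
U_A (plane topology with dyadic lattice paths, p. 9). Used inside GasRegularity / GateFactorisation
(--supports). Sources: Werner2008SelfAvoidingLoops §3. -/
@[route_item "route-CriticalPhenomena-SAWLoopLift"]
def WernerDetermination : Prop :=
  letI : MeasurableSpace (TopologicalSpace.NonemptyCompacts ℂ) := borel (TopologicalSpace.NonemptyCompacts ℂ); ∀ (ν ν' : MeasureTheory.Measure (TopologicalSpace.NonemptyCompacts ℂ)) (c R : ℝ), 0 < c → (∀ᵐ (T : TopologicalSpace.NonemptyCompacts ℂ) ∂ν, ∃ γ : Literature.Probability.RandomPlanarGeometry.CurveClass ℂ, γ ∈ (Literature.Probability.RandomPlanarGeometry.CurveClass.simpleLoop : Set (Literature.Probability.RandomPlanarGeometry.CurveClass ℂ)) ∧ γ.range = (T : Set ℂ)) → (∀ᵐ (T : TopologicalSpace.NonemptyCompacts ℂ) ∂ν', ∃ γ : Literature.Probability.RandomPlanarGeometry.CurveClass ℂ, γ ∈ (Literature.Probability.RandomPlanarGeometry.CurveClass.simpleLoop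 : Set (Literature.Probability.RandomPlanarGeometry.CurveClass ℂ)) ∧ γ.range = (T : Set ℂ)) → (∀ᵐ (T : TopologicalSpace.NonemptyCompacts ℂ) ∂ν, (T : Set ℂ) ⊆ Metric.ball (0 : ℂ) R) → (∀ᵐ (T : TopologicalSpace.NonemptyCompacts ℂ) ∂ν', (T : Set ℂ) ⊆ Metric.ball (0 : ℂ) R) → (∀ (U V : Literature.Probability.RandomPlanarGeometry.JordanDomain) (z : ℂ) (φ : Literature.Probability.RandomPlanarGeometry.ConformalEquiv (Metric.ball (0 : ℂ) 1) U.carrier) (ψ : Literature.Probability.RandomPlanarGeometry.ConformalEquiv (Metric.ball (0 : ℂ) 1) V.carrier), U.carrier ⊆ Metric.ball (0 : ℂ) R → V.carrier ⊆ U.carrier → z ∈ V.carrier → φ 0 = z → ψ 0 = z → ν {T : TopologicalSpace.NonemptyCompacts ℂ | (T : Set ℂ) ⊆ U.carrier ∧ z ∉ (T : Set ℂ) ∧ Bornology.IsBounded (connectedComponentIn (T : Set ℂ)ᶜ z) ∧ ¬ (T : Set ℂ) ⊆ V.carrier} = ENNReal.ofReal (c * Real.log (‖deriv φ 0‖ /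 ‖deriv ψ 0‖))) → (∀ (U V : Literature.Probability.RandomPlanarGeometry.JordanDomain) (z : ℂ) (φ : Literature.Probability.RandomPlanarGeometry.ConformalEquiv (Metric.ball (0 : ℂ) 1) U.carrier) (ψ : Literature.Probability.RandomPlanarGeometry.ConformalEquiv (Metric.ball (0 : ℂ) 1) V.carrier), U.carrier ⊆ Metric.ball (0 : ℂ) R → V.carrier ⊆ U.carrier → z ∈ V.carrier → φ 0 = z → ψ 0 = z → ν' {T : TopologicalSpace.NonemptyCompacts ℂ | (T : Set ℂ) ⊆ U.carrier ∧ z ∉ (T : Set ℂ) ∧ Bornology.IsBounded (connectedComponentIn (T : Set ℂ)ᶜ z) ∧ ¬ (T : Set ℂ) ⊆ V.carrier} = ENNReal.ofReal (c * Real.log (‖deriv φ 0‖ / ‖deriv ψ 0‖))) → ν = ν'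

/-- item stmt-CriticalPhenomena-4852 · assembly · rank 1 · closed · proved by Summit.CriticalPhenomena.SAWScalingLimit.Theorems.sawLoopLift_assembly_proof (prover) · by planner
[assembly] exists_isSLECurve → ConformalRadiusLaw → GasRegularity → BoundaryMixing →
GateFactorisation → AvoidanceToCurves → SAWScalingLimit. Proof (glue, no measure theory): fix D a b
h; μ := law of the SLE_{8/3} curve Γ given by exists_isSLECurve (IsSLECurve.isSLELaw_map); apply
AvoidanceToCurves and fix K; choose R with closure D.carrier ⊆ Metric.ball 0 R (D bounded); c from
ConformalRadiusLaw; ν, ε₀ and the two δ-limits from GasRegularity c; GateFactorisation ν c R gives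
eventual 0 < ν G_ε < ⊤ and the ε-limit of the ratio = μ(avoid K); BoundaryMixing gives ∀ η ∃ ε₀′;
for η > 0 pick ε below all thresholds with |ν-ratio(ε) − μ(avoid K)| < η (Filter.Eventually.exists
on nhdsWithin 0 (Ioi 0)); Tendsto.div (denominator (ν G_ε).toReal > 0) ⇒ eventually |ν_δ-ratio −
ν-ratio| < η; BoundaryMixing ⇒ eventually |P_δ − ν_δ-ratio| < η; so eventually |P_δ(avoid K) −
μ(avoid K)| < 3η, i.e. Tendsto. -/
@[route_item "route-CriticalPhenomena-SAWLoopLift"]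
def Assembly : Prop :=
  ConformalRadiusLaw → GasRegularity → BoundaryMixing → GateFactorisation → AvoidanceToCurves → SAWScalingLimit

/-! D-0027 §2.1 — DECIDING THEOREM (planner-authored via `route open/edit --closes-file`; by planner-rbadge-CriticalPhenomena-SAWLoopLift-4e236abf-g4-0 2026-08-15T16:12:51Z):
its hypotheses are this route's items and its conclusion the sub-problem Statement (glue_lint), and it elaborates with this file. -/

@[closes "route-CriticalPhenomena-SAWLoopLift"] theorem closes : SLELawExists → ConformalRadiusLaw → GasRegularity → BoundaryMixing → GateFactorisation → AvoidanceToCurves → _root_.SAWScalingLimit := by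
  intro hex h1 h2 h3 h4 h5 D a b hab
  -- three-epsilon bookkeeping (pure filters on ℝ): p δ = P_δ(avoid K), q ε δ = lattice gate ratio,
  -- r ε = continuum gate ratio, m = μ(avoid K)
  have key : ∀ (p : ℝ → ℝ) (q : ℝ → ℝ → ℝ) (r : ℝ → ℝ) (m e : ℝ), 0 < e →
      (∀ ε : ℝ, 0 < ε → ε < e → Filter.Tendsto (q ε) (nhdsWithin (0 : ℝ) (Set.Ioi 0)) (nhds (r ε))) →
      Filter.Tendsto r (nhdsWithin (0 : ℝ) (Set.Ioi 0)) (nhds m) →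
      (∀ η : ℝ, 0 < η → ∃ ε₀ : ℝ, 0 < ε₀ ∧ ∀ ε : ℝ, 0 < ε → ε < ε₀ →
        ∀ᶠ δ : ℝ in nhdsWithin (0 : ℝ) (Set.Ioi 0), |p δ - q ε δ| < η) →
      Filter.Tendsto p (nhdsWithin (0 : ℝ) (Set.Ioi 0)) (nhds m) := by
    intro p q r m e he hq hr hp
    rw [Metric.tendsto_nhds]
    intro η hη
    have hη3 : 0 < η / 3 := by positivity
    obtain ⟨ε₀, hε₀, hp'⟩ := hp (η / 3) hη3
    have hev1 : ∀ᶠ ε : ℝ in nhdsWithin (0 : ℝ) (Set.Ioi 0), dist (r ε) m < η / 3 :=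
      (Metric.tendsto_nhds.1 hr) (η / 3) hη3
    have hev2 : ∀ᶠ ε : ℝ in nhdsWithin (0 : ℝ) (Set.Ioi 0), ε ∈ Set.Ioi (0 : ℝ) :=
      eventually_mem_nhdsWithin
    have hev3 : ∀ᶠ ε : ℝ in nhdsWithin (0 : ℝ) (Set.Ioi 0), ε ∈ Set.Iio (min ε₀ e) :=
      mem_nhdsWithin_of_mem_nhds (Iio_mem_nhds (lt_min hε₀ he))
    obtain ⟨ε, hε1, hε2, hε3⟩ := (hev1.and (hev2.and hev3)).exists
    rw [Set.mem_Ioi] at hε2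
    rw [Set.mem_Iio] at hε3
    have hqt := hq ε hε2 (lt_of_lt_of_le hε3 (min_le_right _ _))
    have hpt := hp' ε hε2 (lt_of_lt_of_le hε3 (min_le_left _ _))
    have hqe : ∀ᶠ δ : ℝ in nhdsWithin (0 : ℝ) (Set.Ioi 0), dist (q ε δ) (r ε) < η / 3 :=
      (Metric.tendsto_nhds.1 hqt) (η / 3) hη3
    filter_upwards [hpt, hqe] with δ hδ1 hδ2
    rw [Real.dist_eq] at hε1 hδ2 ⊢
    have t1 : |p δ - m| ≤ |p δ - q ε δ| + |q ε δ - m| := abs_sub_le _ _ _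
    have t2 : |q ε δ - m| ≤ |q ε δ - r ε| + |r ε - m| := abs_sub_le _ _ _
    linarith
  -- μ := a chordal SLE(8/3) law of (D; a, b) (support item SLELawExists)
  obtain ⟨μ, hμ⟩ := hex D
  -- sets-to-curves (AvoidanceToCurves): it suffices to prove convergence of avoidance probabilities
  refine h5 D a b hab μ hμ ?_
  intro K hK hKD hKreg
  -- window radius R with closure Ω ⊆ B(0, R)
  obtain ⟨R, hR⟩ := (D.isBounded.closure).subset_ball (0 : ℂ)
  -- c from the conformal-radius law; ν, gate threshold e and the δ-limits from GasRegularity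
  obtain ⟨c, hc, hC1⟩ := h1
  obtain ⟨ν, hsimple, hball, hCR, hgate⟩ := h2 c hc hC1 R
  obtain ⟨e, he, hG⟩ := hgate D hR
  -- ε-limit of the continuum gate ratio (GateFactorisation); lattice cutting estimate (BoundaryMixing)
  obtain ⟨-, hratio⟩ := h4 ν c R hc hsimple hball hCR D hR μ hμ K hK hKD hKreg
  have hmix := h3 D a b hab R hR K hK hKD hKreg
  refine key _ _ _ _ e he ?_ hratio hmix
  intro ε hε hεe
  obtain ⟨h0, htop, hden, hnumK⟩ := hG ε hε hεe
  have hnum := hnumK K hK hKD hKreg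
  exact hnum.div hden (ne_of_gt (ENNReal.toReal_pos h0.ne' htop.ne))

end Summit.CriticalPhenomena.SAWScalingLimit.Theses.SAWLoopLift
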